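/-
Copyright: the b2b-balaban T⁴-continuum CRUX team, row NE7b OWNER lineage `t4-ne7b-p1` (gen 119). Project licence.
-/
import Summits.QuantumFields.BalabanUV.T4Continuum.Spine.NE7b.SupConvexStepIntegrated
import Summits.QuantumFields.BalabanUV.T4Continuum.Spine.NE7b.SupConvexStepLaplace
import Summits.QuantumFields.BalabanUV.T4Continuum.Spine.NE7b.SupConvexClassTwoSidedAction

/-!
# THE INTEGRATED BLOCK-SPIN STEP ON THE TORUS: for the torus action `S φ = ½Σ φ·(Rf(A(Ef φ))) + Σ v(φ x)` with `v′ = u`, `|u′| ≤ λ`,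
# `λ < min(2,a)`, the torus block mean `Q′t = Rc∘Dop∘Ef` with its block lift `M` and ANY injective chart `P` of `ker Q′t`, the
# INTEGRATED effective action `W_int(w) = −log ∫ e^{−S(M w + P z)} dz` on the coarse torus is DIFFERENTIABLE everywhere, obeys the
# first-order letter with modulus `(min(2,a) − λ)(n+1)^d` and an upper letter, and is sandwiched against the background action
# `S(Φ w)` of (93)∕(110): `S(Φ w) − |σ|·log √(2π∕((min(2,a) − λ)p)) ≤ W_int(w)` — every mesh `n`, period `s`, dimension `d`
# (row NE7b, node U5c; (116) + (117) + (118) + (110) + (96) + (89) BY NAME; [folklore])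

Cell `pub-balaban`, sub-cell `t4`, spine estimate NE7b (`T4WeightBudget.RelWeightBound`; the cell's OWN estimate — NOT PRINTED in
[Bałaban 1983–89], NOT PROVED).  Crux-route work under `Spine/NE7b/` by the row OWNER (`t4-ne7b-p1` gen 119) under FREEZE (0)'s
crux-prover clause — the torus instance of the gen's integrated-step column, the measure-side twin of (112)'s `torus_twoStep_tower`;
NOTHING of Bałaban's is named as a Lean object, valued or asserted; no `T4Continuum/Support` leaf typed; no `def`, no notation; zero
`sorry`.  Imports (BY NAME): the OWNER's (116) `…SupConvexStepIntegrated` (`integratedStep_closure`), (117) `…SupConvexStepLaplace`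
(`fibreMin_le_negLog_fibreIntegral`), (118) `…SupConvexClassTwoSidedAction` (`torus_action_mem_twoSided`); through them (110)
`step_closure`, (114) `sum_sq_le_card_mul_norm_sq`, (96) `exists_clm_blockLift`, (93) `norm_sq_le_sum_sq` ∕ `sitewise_of_critical`, (89)
`blockVolume_mul_sum_sq_blockAvg_le`.

WHY (located).  (112) instantiated the MINIMISING step on the torus; this file instantiates the INTEGRATED step: the torus action is in
the two-sided class by (118) (`m = min(2,a) − λ`, `Λ = |Site|·‖At‖ + λ`), the block mean has the block lift as right inverse with block
Jensen constant `(n+1)^d` ((96), (89)) and the crude lift ceiling `Σ(M k)² ≤ |Site|‖M‖²·Σ k²` ((114) + (93)), so (116)'s closure and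
(117)'s Laplace lower bound apply along any chart `P` of `ker Q′t` — the chart is the only datum left quantified (an explicit chart of
the zero-mean fields, e.g. «all sites of a block but one», is bookkeeping not typed here).

WHAT IS PROVED ([folklore]; the `Beta.Site` carriers):
* §1 `lift_sum_sq_le` (the crude ceiling of any continuous linear `M` on finite carriers: `Σ(M k)² ≤ |ι|‖M‖²·Σ k²`).
* §2 **`torus_integratedStep`** (THE END: `|u′| ≤ λ < min(2,a)`; `P` with `Q′t∘P = 0`, `p·Σ z² ≤ Σ(P z)²`, `p > 0` ⟹ `∃ M Φ W′`: `M` the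
  block lift (`Q′t∘M = 1`), `Φ` the torus background map (block means + sitewise equation), and for
  `W_int(w) = −log ∫ e^{−S(M w + P z)} dz`: `HasFDerivAt W_int (W′ w) w` everywhere, the lower letter with modulus
  `(min(2,a) − λ)(n+1)^d`, the upper letter with modulus `(|Site|‖At‖ + λ)·|Site|‖M‖²`, and the Laplace bound
  `S(Φ w) − |σ|·log √(2π∕((min(2,a) − λ)p)) ≤ W_int(w)` at every `w`).
* §3 toy.

HONEST (what this is NOT).  Assembly by name; the upper modulus and the lift ceiling are VOLUME-DEPENDENT (honest — uniform ones
need the kernel's row sums and the exact lift identity `Σ(M k)² = (n+1)^dΣ k²`, not typed); the chart `P` is quantified, not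
constructed; no locality; `φ⁴` excluded (`|u′| ≤ λ`); cubic periods; scalar skeleton, hard constraint ((A3), NC-NE7b-α UNRULED); nothing
of Bałaban's.  BY-NAME EFFECT ON THE WALL: NONE.  NE7b NOT PRINTED ∕ NOT PROVED; spine PROVED 0∕9; rung (B)+1 on a FINITE torus — NOT
infinite volume, NOT the mass gap, NOT Clay.  HONEST DEPENDENCY: continuum YM on T⁴ ⇐ BetaPertH ∧ nine spine estimates (0∕9 proved);
BetaPertH ⇐ (D1) ∧ (D4) ∧ CAP+tail; G-an2-4 gates asym, D1 and NE2∕3∕4.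
-/

set_option autoImplicit false

noncomputable section

namespace Summit.QuantumFields.BalabanUV.T4Continuum.NE7b.SupConvexStepIntegratedTorus

open Set Function MeasureTheory Real
open scoped ENNReal
open Literature.MathematicalPhysics.QuantumFieldTheory.Balaban1983to89
open B6QGQLower276 (X blk B side AX)
open B5Hk103ScalarZd (nbhd)
open Beta (Site siteOf windowMap)
open SupTorusDirichletFormCoercive (blockVolume_mul_sum_sq_blockAvg_le)
open SupTorusActionMinimiser (norm_sq_le_sum_sq sitewise_of_critical)
open SupTorusEffectiveActionGradient (exists_clm_blockLift)
open SupConvexStepSemigroup (step_closure)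
open SupConvexClassEnvelope (sum_sq_le_card_mul_norm_sq)
open SupConvexStepIntegrated (integratedStep_closure)
open SupConvexStepLaplace (fibreMin_le_negLog_fibreIntegral)
open SupConvexClassTwoSidedAction (torus_action_mem_twoSided)

variable {d : ℕ}

/-! ## §1. The crude ceiling of a lift -/

section Lift

variable {ι κ : Type*} [Fintype ι] [Fintype κ]

/-- **THE CRUDE CEILING OF ANY CONTINUOUS LINEAR MAP BETWEEN FINITE CARRIERS**: `Σ_x (M k x)² ≤ |ι|·‖M‖²·Σ_y (k y)²` (sup norms;
volume-dependent). [folklore] -/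
theorem lift_sum_sq_le (M : (κ → ℝ) →L[ℝ] (ι → ℝ)) (k : κ → ℝ) :
    ∑ x, M k x ^ 2 ≤ Fintype.card ι * ‖M‖ ^ 2 * ∑ y, k y ^ 2 := by
  have h1 := sum_sq_le_card_mul_norm_sq (M k)
  have h2 : ‖M k‖ ^ 2 ≤ (‖M‖ * ‖k‖) ^ 2 := pow_le_pow_left₀ (norm_nonneg _) (M.le_opNorm k) 2
  have h3 := norm_sq_le_sum_sq k
  have h4 : 0 ≤ (Fintype.card ι : ℝ) * ‖M‖ ^ 2 := by positivity
  calc ∑ x, M k x ^ 2 ≤ Fintype.card ι * ‖M k‖ ^ 2 := h1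
    _ ≤ Fintype.card ι * (‖M‖ * ‖k‖) ^ 2 := mul_le_mul_of_nonneg_left h2 (Nat.cast_nonneg _)
    _ = Fintype.card ι * ‖M‖ ^ 2 * ‖k‖ ^ 2 := by ring
    _ ≤ Fintype.card ι * ‖M‖ ^ 2 * ∑ y, k y ^ 2 := mul_le_mul_of_nonneg_left h3 h4

end Lift

/-! ## §2. The integrated step on the torus -/

section Torus

variable (n : ℕ) (a : ℝ) (s : ℕ) [NeZero s]
  {Dop Aop : lp (fun _ : X d => ℝ) ∞ →L[ℝ] lp (fun _ : X d => ℝ) ∞}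
  (hD : ∀ (f : lp (fun _ : X d => ℝ) ∞) (y : X d), Dop f y = (((n : ℝ) + 1) ^ d)⁻¹ * ∑ p ∈ B n y, f p)
  (hA : ∀ (f : lp (fun _ : X d => ℝ) ∞) (p : X d), Aop f p = ∑ r ∈ nbhd n p, AX n a p r * f r)
  {v u u' : ℝ → ℝ} (hv : ∀ t, HasDerivAt v (u t) t) (hu : ∀ t, HasDerivAt u (u' t) t)
  {lam : ℝ} (hlam : ∀ t, |u' t| ≤ lam) (hγ : lam < min 2 a)
  {Ef : (Site d ((n + 1) * s) → ℝ) →L[ℝ] lp (fun _ : X d => ℝ) ∞}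
  (hEf : ∀ (g : Site d ((n + 1) * s) → ℝ) (q : X d), Ef g q = g (siteOf d ((n + 1) * s) q))
  {Rf : lp (fun _ : X d => ℝ) ∞ →L[ℝ] (Site d ((n + 1) * s) → ℝ)}
  (hRf : ∀ (h : lp (fun _ : X d => ℝ) ∞) (x : Site d ((n + 1) * s)), Rf h x = h (windowMap d ((n + 1) * s) x))
  {Rc : lp (fun _ : X d => ℝ) ∞ →L[ℝ] (Site d s → ℝ)}
  (hRc : ∀ (h : lp (fun _ : X d => ℝ) ∞) (x : Site d s), Rc h x = h (windowMap d s x))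

include hD hA hv hu hlam hγ hEf hRf hRc in
/-- **THE END: THE INTEGRATED BLOCK-SPIN STEP ON THE TORUS.**  `v′ = u`, `|u′| ≤ λ`, `λ < min(2,a)`; `σ` ANY finite type and `P` ANY
continuous linear chart of the zero-mean fields (`Q′t∘P = 0`) with `p·Σ z² ≤ Σ(P z)²`, `p > 0`.  Then there are the block lift `M`
(`Q′t(M k) = k`), the torus background map `Φ` (block means `Q′t(Φ w) = w` and the sitewise equation at every `w`) and a derivative
family `W′` of the integrated effective action `W_int(w) = −log ∫ e^{−S(M w + P z)} dz` such that at every coarse field: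
`HasFDerivAt W_int (W′ w) w`; the first-order letter with modulus `(min(2,a) − λ)(n+1)^d`; the upper letter with modulus
`(|Site d ((n+1)s)|·‖Rf∘A∘Ef‖ + λ)·|Site d ((n+1)s)|·‖M‖²`; and the Laplace bound `S(Φ w) − |σ|·log √(2π∕((min(2,a) − λ)p)) ≤ W_int(w)`.
[folklore] -/
theorem torus_integratedStep {σ : Type*} [Fintype σ] (P : (σ → ℝ) →L[ℝ] (Site d ((n + 1) * s) → ℝ))
    (hQP : ∀ z : σ → ℝ, ((Rc.comp Dop).comp Ef) (P z) = 0) {p : ℝ}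
    (hP : ∀ z : σ → ℝ, p * ∑ i, z i ^ 2 ≤ ∑ x, P z x ^ 2) (hp : 0 < p) :
    ∃ (M : (Site d s → ℝ) →L[ℝ] (Site d ((n + 1) * s) → ℝ)) (Φ : (Site d s → ℝ) → (Site d ((n + 1) * s) → ℝ))
      (W' : (Site d s → ℝ) → (Site d s → ℝ) →L[ℝ] ℝ),
      (∀ k, ((Rc.comp Dop).comp Ef) (M k) = k) ∧
      (∀ w, ((Rc.comp Dop).comp Ef) (Φ w) = w) ∧
      (∀ (w : Site d s → ℝ) (q : X d), Aop (Ef (Φ w)) q + u (Ef (Φ w) q)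
        = (((n : ℝ) + 1) ^ d)⁻¹ * ∑ q' ∈ B n (blk n q), (Aop (Ef (Φ w)) q' + u (Ef (Φ w) q'))) ∧
      (∀ w, HasFDerivAt (fun w : Site d s → ℝ => -log (∫ z : σ → ℝ,
          exp (-((1 / 2 : ℝ) * ∑ x, (M w + P z) x * ((Rf.comp Aop).comp Ef) (M w + P z) x + ∑ x, v ((M w + P z) x)))))
        (W' w) w) ∧
      (∀ w w' : Site d s → ℝ,
        -log (∫ z : σ → ℝ,
            exp (-((1 / 2 : ℝ) * ∑ x, (M w + P z) x * ((Rf.comp Aop).comp Ef) (M w + P z) x + ∑ x, v ((M w + P z) x))))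
          + W' w (w' - w) + (min 2 a - lam) * ((n : ℝ) + 1) ^ d / 2 * ∑ y, (w' y - w y) ^ 2 ≤
        -log (∫ z : σ → ℝ,
            exp (-((1 / 2 : ℝ) * ∑ x, (M w' + P z) x * ((Rf.comp Aop).comp Ef) (M w' + P z) x + ∑ x, v ((M w' + P z) x))))) ∧
      (∀ w w' : Site d s → ℝ,
        -log (∫ z : σ → ℝ,
            exp (-((1 / 2 : ℝ) * ∑ x, (M w' + P z) x * ((Rf.comp Aop).comp Ef) (M w' + P z) x + ∑ x, v ((M w' + P z) x))))
          ≤ -log (∫ z : σ → ℝ,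
            exp (-((1 / 2 : ℝ) * ∑ x, (M w + P z) x * ((Rf.comp Aop).comp Ef) (M w + P z) x + ∑ x, v ((M w + P z) x))))
          + W' w (w' - w)
          + (Fintype.card (Site d ((n + 1) * s)) * ‖(Rf.comp Aop).comp Ef‖ + lam)
              * (Fintype.card (Site d ((n + 1) * s)) * ‖M‖ ^ 2) / 2 * ∑ y, (w' y - w y) ^ 2) ∧
      ∀ w : Site d s → ℝ,
        ((1 / 2 : ℝ) * ∑ x, Φ w x * ((Rf.comp Aop).comp Ef) (Φ w) x + ∑ x, v (Φ w x))
          - Fintype.card σ * log (√(2 * π / ((min 2 a - lam) * p))) ≤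
        -log (∫ z : σ → ℝ,
            exp (-((1 / 2 : ℝ) * ∑ x, (M w + P z) x * ((Rf.comp Aop).comp Ef) (M w + P z) x + ∑ x, v ((M w + P z) x)))) := by
  obtain ⟨M, -, hM⟩ := exists_clm_blockLift n s hD hEf hRc
  obtain ⟨hS, hlo, hup⟩ := torus_action_mem_twoSided n a s hA hv hu hlam hEf hRf
  have hm : 0 < min 2 a - lam := sub_pos.2 hγ
  have hlam0 : 0 ≤ lam := (abs_nonneg _).trans (hlam 0)
  have hΛ : 0 ≤ Fintype.card (Site d ((n + 1) * s)) * ‖(Rf.comp Aop).comp Ef‖ + lam := by positivity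
  have hJ : ∀ h : Site d ((n + 1) * s) → ℝ,
      ((n : ℝ) + 1) ^ d * ∑ y, ((Rc.comp Dop).comp Ef) h y ^ 2 ≤ ∑ x, h x ^ 2 := fun h => by
    simpa only [ContinuousLinearMap.comp_apply] using blockVolume_mul_sum_sq_blockAvg_le n s hD hEf hRc h
  have hμ : ∀ k : Site d s → ℝ, ∑ x, M k x ^ 2 ≤ Fintype.card (Site d ((n + 1) * s)) * ‖M‖ ^ 2 * ∑ y, k y ^ 2 :=
    fun k => lift_sum_sq_le M k
  -- the background map of (110) (block means + fibre-criticality ⟹ the sitewise equation by (93))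
  obtain ⟨Φ, hΦQ, hΦcrit, hΦmin, -, -, -⟩ := step_closure hS hlo hm ((Rc.comp Dop).comp Ef) M hM hJ
  -- the integrated step of (116) and the Laplace bound of (117)
  obtain ⟨W', hW', hWlo, hWup⟩ :=
    integratedStep_closure ((Rc.comp Dop).comp Ef) M P hS hlo hm hup hΛ hM hμ hJ hQP hP hp
  refine ⟨M, Φ, W', hM, hΦQ, fun w q => sitewise_of_critical n a s hD hA hEf hRf hRc hv (Φ w) (hΦcrit w) q, hW',
    fun w w' => ?_, hWup, fun w => ?_⟩
  · have h := hWlo w w'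
    simpa only [mul_div_assoc, mul_assoc] using h
  · exact fibreMin_le_negLog_fibreIntegral ((Rc.comp Dop).comp Ef) M P hS hlo hm hM hQP hP hp hΦmin w

end Torus

/-! ## §3. Toy -/

/-- Toy (§1 with the identity lift on one site: `Σ k² ≤ 1·‖1‖²·Σ k²`). -/
example (k : Unit → ℝ) :
    ∑ x, (ContinuousLinearMap.id ℝ (Unit → ℝ)) k x ^ 2 ≤
      Fintype.card Unit * ‖ContinuousLinearMap.id ℝ (Unit → ℝ)‖ ^ 2 * ∑ y, k y ^ 2 :=
  lift_sum_sq_le _ k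

end Summit.QuantumFields.BalabanUV.T4Continuum.NE7b.SupConvexStepIntegratedTorus

end
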